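import Summits.BirchSwinnertonDyer.BirchSwinnertonDyer.Theorems.ClassRecordThreeEulerHalvesAtThreeChebSupplyOrder
import Literature.NumberTheory.GaloisRepresentations.AbsGaloisOuterConj
import Literature.NumberTheory.GaloisRepresentations.IntegralGaloisAction
import Mathlib.FieldTheory.Finite.Basic
import Mathlib.Algebra.CharP.Lemmas
import HarnessLib

/-!
# The Frobenius dictionary for `stub_chebotarevSupplyAtThree` (crux 19109, line `inert`; STUB-PLAN
# part C3 (iii)): at an arithmetic Frobenius `σ` with `σ ζ = ζ⁻¹`, `σ² C ≠ C`, the order condition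
# `β^d ≡ a (mod ℓ𝓞_K) ⟹ 3^e ∣ d`

Crux `stmt-BirchSwinnertonDyer-19109` (`EulerHalvesAtThree`), line `inert` (tam3-p1 g18, skeleton r19),
registered stub `stub_chebotarevSupplyAtThree`.  After NON-EMPTINESS (`…ChebSupplyNonempty`, p652012) and
before DENSITY, this file translates "`σ` is an arithmetic Frobenius at `𝔓 ∣ ℓ` lying in the open
set of the Chebotarev class" into the ARITHMETIC conclusion of the stub about `β`:

* `three_pow_dvd_of_isArithFrobAt` — the statement in the title (docstring there), reducing `ℤ̄`
  modulo `𝔓` (a field; Frobenius `x ↦ x^ℓ` by `IsArithFrobAt`; `τ` acts on `𝓞_K ⊂ ℤ̄` through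
  `absGaloisQuot`, `smul_absEmbeddingInt`) and applying the pure-algebra lemma
  `ChebSupply.three_pow_dvd_of_frobenius_data` (p651865).

HONEST FRAMING: one part of one registered stub of one line of crux 19109; nothing about BSD for any curve
is proved here.

## References

* J. Neukirch, *Algebraic Number Theory* (1999), Ch. I §8 (residue fields), §9 (Frobenius). [NeukirchANT1999]

## Mathlib / tree search

Tree: `absIntegers`, `absEmbeddingInt`, `smul_absEmbeddingInt`, `absGaloisQuot` (`AbsGaloisOuterConj`,
`IntegralGaloisAction`); `ChebSupply.three_pow_dvd_of_frobenius_data` (p651865).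
Mathlib: `IsArithFrobAt` (`σ • x - x^q ∈ 𝔓`), `Ideal.Quotient.field`, `Ideal.Quotient.eq_zero_iff_mem`,
`integralClosure.coe_smul`, `IsPrimitiveRoot.pow`, `orderOf_eq_prime_pow`, `orderOf_dvd_of_pow_eq_one`,
`CharP.charP_iff_prime_eq_zero`, `frobenius_def`, `map_intCast`, `pow_card_eq_one'`.
-/

noncomputable section

set_option autoImplicit false
set_option linter.dupNamespace false

open scoped NumberField
open Field Polynomial IsDedekindDomain Literature.NumberTheory.GaloisRepresentations

namespace Summit.BirchSwinnertonDyer.BirchSwinnertonDyer.Theorems.ChebSupply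

variable {K : Type} [Field K] [NumberField K]

/-- **The Kummer dictionary at a Frobenius** (STUB-PLAN C3 (iii)).  Let `K` be quadratic, `σ ∈ Γ_ℚ`
an arithmetic Frobenius at a maximal ideal `𝔓` of `ℤ̄` with `#(ℤ/𝔓 ∩ ℤ) = ℓ` (`ℓ ∈ 𝔓` prime, `ℓ ≠ 3`),
acting on `K` like `σ₀` (`absGaloisQuot σ = absGaloisQuot σ₀`, i.e. as complex conjugation `τ`).
Suppose `σ ζ = ζ⁻¹` for a primitive `3^{e+k}`-th root of unity `ζ ∈ ℤ̄`, `σ² C = θ C` with `C ∈ ℤ̄`,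
`θ³ = 1 ≠ θ` (the square of the Frobenius MOVES the cube root `C`, `C³ = g`), and the relation
`β γ₂^{3^{k+1}} = (τβ) g^{3^k}` in `𝓞_K` (i.e. `β/β̄ = γ₀^{3^k}`, `γ₀ = g/γ₂³`) with `β, γ₂, g ∉ 𝔓`.
Then **every `d` with `β^d ≡ a (mod ℓ𝓞_K)`, `a ∈ ℤ`, is divisible by `3^e`**: in the residue field
`ℤ̄/𝔓` the Frobenius is `x ↦ x^ℓ`, so `β̄' = β̄^ℓ`, `C̄^{ℓ²} = θ̄ C̄`, `γ̄₂^{ℓ²} = γ̄₂` (`τ² = 1`),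
`ζ̄` has order `3^{e+k} ∣ ℓ + 1` (a primitive cube root of unity is `≢ 1` as `3 ∉ 𝔓`), and
`ChebSupply.three_pow_dvd_of_frobenius_data` (p651865) concludes. [cite: NeukirchANT1999, Ch. I §8–§9] -/
theorem three_pow_dvd_of_isArithFrobAt [Algebra.IsQuadraticExtension ℚ K]
    {σ σ₀ : absoluteGaloisGroup ℚ}
    {𝔓 : Ideal (absIntegers (𝓞 ℚ) ℚ)} [𝔓.IsMaximal] (hfrob : IsArithFrobAt (𝓞 ℚ) σ 𝔓)
    {ℓ : ℕ} (hℓ : ℓ.Prime) (hq : Nat.card (𝓞 ℚ ⧸ 𝔓.under (𝓞 ℚ)) = ℓ)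
    (hℓ𝔓 : (ℓ : absIntegers (𝓞 ℚ) ℚ) ∈ 𝔓) (hℓ3 : ℓ ≠ 3)
    (hquot : absGaloisQuot ℚ K σ = absGaloisQuot ℚ K σ₀)
    {e k : ℕ} {ζ C θ : absIntegers (𝓞 ℚ) ℚ}
    (hζ : IsPrimitiveRoot (ζ : AlgebraicClosure ℚ) (3 ^ (e + k)))
    (hσζ : σ • (ζ : AlgebraicClosure ℚ) = (ζ : AlgebraicClosure ℚ)⁻¹)
    (hθ3 : θ ^ 3 = 1) (hθ1 : θ ≠ 1) (hσC : σ • (σ • C) = θ * C)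
    {β g γ₂ : 𝓞 K} (hC : C ^ 3 = absEmbeddingInt ℚ K g)
    (hrel : β * γ₂ ^ 3 ^ (k + 1) = (absGaloisQuot ℚ K σ₀ • β) * g ^ 3 ^ k)
    (hβ𝔓 : absEmbeddingInt ℚ K β ∉ 𝔓) (hγ₂𝔓 : absEmbeddingInt ℚ K γ₂ ∉ 𝔓)
    (hg𝔓 : absEmbeddingInt ℚ K g ∉ 𝔓)
    {d : ℕ} {a : ℤ} (hd : β ^ d - (a : 𝓞 K) ∈ Ideal.span {(ℓ : 𝓞 K)}) : 3 ^ e ∣ d := by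
  classical
  have h2 : Module.finrank ℚ K = 2 := Algebra.IsQuadraticExtension.finrank_eq_two ℚ K
  letI : Field (absIntegers (𝓞 ℚ) ℚ ⧸ 𝔓) := Ideal.Quotient.field 𝔓
  set π := Ideal.Quotient.mk 𝔓 with hπ
  have hπmem : ∀ x, π x = 0 ↔ x ∈ 𝔓 := fun x => Ideal.Quotient.eq_zero_iff_mem
  -- Frobenius: `π (σ x) = (π x) ^ ℓ`
  have hF : ∀ x : absIntegers (𝓞 ℚ) ℚ, π (σ • x) = π x ^ ℓ := fun x => by
    have h := hfrob x
    rw [hq] at h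
    rw [← map_pow, hπ, Ideal.Quotient.eq]
    exact h
  -- `3 ∉ 𝔓`
  have h3 : (3 : absIntegers (𝓞 ℚ) ℚ) ∉ 𝔓 := by
    intro h3
    have hcop : Nat.Coprime 3 ℓ := (Nat.coprime_primes Nat.prime_three hℓ).mpr (Ne.symm hℓ3)
    obtain ⟨u, w, huw⟩ := Nat.isCoprime_iff_coprime.mpr hcop
    apply Ideal.IsPrime.ne_top' ((Ideal.eq_top_iff_one 𝔓).mpr _)
    have h := congrArg (fun z : ℤ => (z : absIntegers (𝓞 ℚ) ℚ)) huw
    simp only [Int.cast_add, Int.cast_mul, Int.cast_natCast, Int.cast_one] at h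
    rw [← h]
    exact Ideal.add_mem _ (Ideal.mul_mem_left _ _ h3) (Ideal.mul_mem_left _ _ hℓ𝔓)
  -- a primitive cube root of unity `η` of `A` (`η³ = 1`, `η ≠ 1`) is not `≡ 1`
  have hcube : ∀ η : absIntegers (𝓞 ℚ) ℚ, η ^ 3 = 1 → η ≠ 1 → π η ≠ 1 := by
    intro η hη3 hη1 hπη
    have hq2 : η ^ 2 + η + 1 = 0 := by
      have : (η - 1) * (η ^ 2 + η + 1) = 0 := by ring_nf; rw [hη3]; ring
      exact (mul_eq_zero.mp this).resolve_left (sub_ne_zero.mpr hη1)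
    apply h3
    rw [← hπmem]
    have h := congrArg π hq2
    rw [map_add, map_add, map_pow, hπη, map_one, map_zero] at h
    rw [map_ofNat]
    norm_num at h ⊢
    exact h
  -- `3^(e+k) ∣ ℓ + 1` from `σ ζ = ζ⁻¹`
  have hζ0 : (ζ : AlgebraicClosure ℚ) ≠ 0 := hζ.ne_zero (pow_ne_zero _ (by norm_num))
  have hζ1 : (σ • ζ) * ζ = 1 := by
    apply Subtype.ext
    rw [Subalgebra.coe_mul, integralClosure.coe_smul, hσζ, inv_mul_cancel₀ hζ0, Subalgebra.coe_one]
  have hζpow : ζ ^ 3 ^ (e + k) = 1 := by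
    apply Subtype.ext
    rw [Subalgebra.coe_pow, hζ.pow_eq_one, Subalgebra.coe_one]
  have hE : 3 ^ (e + k) ∣ ℓ + 1 := by
    -- `orderOf (π ζ) = 3^(e+k)` and `(π ζ)^(ℓ+1) = 1`
    have hpow1 : π ζ ^ (ℓ + 1) = 1 := by
      rw [pow_succ, ← hF, ← map_mul, hζ1, map_one]
    rcases Nat.eq_zero_or_pos (e + k) with h0 | hpos
    · rw [h0, pow_zero]; exact one_dvd _
    · obtain ⟨n, hn⟩ : ∃ n, e + k = n + 1 := ⟨e + k - 1, (Nat.sub_add_cancel hpos).symm⟩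
      have hord : orderOf (π ζ) = 3 ^ (e + k) := by
        rw [hn]
        apply orderOf_eq_prime_pow
        · -- `ζ' = ζ^(3^n)` is a primitive cube root of unity
          intro h1
          have hprim : IsPrimitiveRoot ((ζ : AlgebraicClosure ℚ) ^ 3 ^ n) 3 :=
            hζ.pow (pow_pos (by norm_num) _) (by rw [hn, pow_succ])
          refine hcube (ζ ^ 3 ^ n) ?_ ?_ (by rw [map_pow, h1])
          · apply Subtype.ext
            rw [Subalgebra.coe_pow, Subalgebra.coe_pow, hprim.pow_eq_one, Subalgebra.coe_one]
          · intro h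
            have := congrArg (fun z : absIntegers (𝓞 ℚ) ℚ => (z : AlgebraicClosure ℚ)) h
            simp only [Subalgebra.coe_pow, Subalgebra.coe_one] at this
            exact hprim.ne_one (by norm_num) this
        · rw [← hn, ← map_pow, hζpow, map_one]
      rw [← hord]
      exact orderOf_dvd_of_pow_eq_one hpow1
  -- the residue-field data
  haveI : Fact ℓ.Prime := ⟨hℓ⟩
  have hℓ0 : (ℓ : absIntegers (𝓞 ℚ) ℚ ⧸ 𝔓) = 0 := by
    rw [← map_natCast π, hπmem]; exact hℓ𝔓
  haveI : CharP (absIntegers (𝓞 ℚ) ℚ ⧸ 𝔓) ℓ := (CharP.charP_iff_prime_eq_zero hℓ).mpr hℓ0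
  have hb : π (absEmbeddingInt ℚ K β) ≠ 0 := fun h => hβ𝔓 ((hπmem _).mp h)
  have hg₂ : π (absEmbeddingInt ℚ K γ₂) ≠ 0 := fun h => hγ₂𝔓 ((hπmem _).mp h)
  have hCne : π C ≠ 0 := by
    intro h
    apply hg𝔓
    rw [← hC, ← hπmem, map_pow, h]
    ring
  have hθF3 : π θ ^ 3 = 1 := by rw [← map_pow, hθ3, map_one]
  have hθF1 : π θ ≠ 1 := hcube θ hθ3 hθ1
  have hCfrob : π C ^ (ℓ ^ 2) = π θ * π C := by
    rw [pow_two, pow_mul, ← hF, ← hF, hσC, map_mul]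
  -- `σ² = 1` on `K`: `(quot σ)² = 1`
  have hquot2 : absGaloisQuot ℚ K σ * absGaloisQuot ℚ K σ = 1 := by
    have hcard : Nat.card (K ≃ₐ[ℚ] K) = 2 := by rw [IsGalois.card_aut_eq_finrank, h2]
    rw [← pow_two, ← hcard]; exact pow_card_eq_one'
  have hg₂frob : π (absEmbeddingInt ℚ K γ₂) ^ (ℓ ^ 2) = π (absEmbeddingInt ℚ K γ₂) := by
    rw [pow_two, pow_mul, ← hF, ← hF, smul_absEmbeddingInt, smul_absEmbeddingInt, ← mul_smul,
      hquot2, one_smul]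
  have hrelF : π (absEmbeddingInt ℚ K β) * π (absEmbeddingInt ℚ K γ₂) ^ 3 ^ (k + 1) =
      π (absEmbeddingInt ℚ K β) ^ ℓ * (π C ^ 3) ^ 3 ^ k := by
    have h := congrArg (fun z => π (absEmbeddingInt ℚ K z)) hrel
    simp only [map_mul, map_pow] at h
    rw [h, ← hquot, ← smul_absEmbeddingInt, hF, ← hC, map_pow]
  have hdF : (π (absEmbeddingInt ℚ K β) ^ d) ^ ℓ = π (absEmbeddingInt ℚ K β) ^ d := by
    -- `β^d ≡ a (mod ℓ)` ⟹ `π(β)^d = a`, and `a^ℓ = a` in characteristic `ℓ`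
    obtain ⟨z, hz⟩ := Ideal.mem_span_singleton'.mp hd
    have hβd : π (absEmbeddingInt ℚ K β) ^ d = (a : absIntegers (𝓞 ℚ) ℚ ⧸ 𝔓) := by
      have h := congrArg (fun w => π (absEmbeddingInt ℚ K w)) hz
      simp only [map_mul, map_natCast, map_sub, map_pow, map_intCast] at h
      rw [hℓ0, mul_zero] at h
      exact (sub_eq_zero.mp h.symm)
    rw [hβd]
    exact (frobenius_def (p := ℓ) (a : absIntegers (𝓞 ℚ) ℚ ⧸ 𝔓)).symm.trans (map_intCast (frobenius _ ℓ) a)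
  exact three_pow_dvd_of_frobenius_data hℓ hE hb hg₂ hCne hθF3 hθF1 hCfrob hg₂frob hrelF hdF

end Summit.BirchSwinnertonDyer.BirchSwinnertonDyer.Theorems.ChebSupply

end
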